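import Literature.AlgebraicGeometry.Frobenioids.NumberFieldLocalizationCategories
import Literature.AlgebraicGeometry.Frobenioids.BCatOrbits
import HarnessLib

/-!
# Frobenioids II, Example 1.4 (ii): the "one verifies immediately" claims about `E₀ → P₀` (proofs)

Mochizuki, *The geometry of Frobenioids II*, Kyushu J. Math. **62** (2008) 401–460, §1 Example 1.4
(ii), author's text p. 13 [cite: MochizukiFrdII2008, Ex. 1.4 (ii) p.13].  The statement file
`NumberFieldLocalizationCategories.lean` (seat abc-iut-L1-t8) types the nine printed claims about the
categories `Q₀ = B(G)⁰`, `P₀ = B(D)⁰`, `E₀` (triples `(P, Q, ι : P ↪ Q|_D)`) and the functor `E₀ → P₀` as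
named statements `NFLocCat.EConnected`, …, `NFLocCat.PTotallyEpimorphic` over a topological group `G`
and a subgroup `D` (the paper's `G = Gal(F̃/F)`, `D = D_v`).  This PROOF-ONLY companion discharges
them, for `G` a topological group (`[IsTopologicalGroup G]`; the arrow-wise essential surjectivity
needs `G` profinite, as `Gal(F̃/F)` is): every argument reduces, via the toolkit `BCatOrbits.lean`
(connected objects of `B(G)` = single orbits; coset objects `G/U`), to elementary manipulations of
finite `G`-sets.  On `AutBijective` see `autBijective_injective` (the injectivity half) — the typing
seat's docstring records that surjectivity fails for `(G, D) ≅ (S₃, A₃)`; nothing is restated here.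
-/

namespace Literature.AlgebraicGeometry.Frobenioids

namespace NFLocCat

open CategoryTheory CategoryTheory.Limits
open scoped FintypeCatDiscrete

universe u

section General

variable {G : Type u} [Group G] [TopologicalSpace G] [IsTopologicalGroup G]

/-- The one-point `G`-set: a connected object of `B(G)` with a single point (it receives a morphism
from every object). [cite: MochizukiFrdII2008, Ex. 1.4 (ii) p.13] -/
theorem exists_point_obj (G : Type u) [Group G] [TopologicalSpace G] [IsTopologicalGroup G] :
    ∃ (T : BCat G) (t₀ : T.obj.V), IsConnectedObj T ∧ ∀ t : T.obj.V, t = t₀ := by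
  let TA : Action FintypeCat.{u} G := { V := FintypeCat.of PUnit.{u + 1}, ρ := 1 }
  have hT : Action.IsContinuous TA := BCat.isContinuous_of_smul_eq TA fun _ _ => rfl
  refine ⟨⟨TA, hT⟩, PUnit.unit, ?_, fun _ => rfl⟩
  exact BCat.isConnectedObj_of_transitive ⟨TA, hT⟩ PUnit.unit fun _ => ⟨1, rfl⟩

/-- `B(G)⁰` (the connected objects of `B(G)`, [FrdI] §0) is totally epimorphic: every morphism between
single orbits is surjective. [cite: MochizukiFrdII2008, Prop. 1.5 (iii) p.14] -/
theorem isTotallyEpimorphic_connectedPart (G : Type u) [Group G] [TopologicalSpace G]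
    [IsTopologicalGroup G] : IsTotallyEpimorphic (ConnectedPart (BCat G)) := by
  refine ⟨fun {A B} f => ⟨fun g h e => ?_⟩⟩
  haveI : Epi f.hom := BCat.epi_of_isConnectedObj f.hom A.property.1 B.property
  have e' : f.hom ≫ g.hom = f.hom ≫ h.hom := congrArg InducedCategory.Hom.hom e
  exact ObjectProperty.hom_ext _ ((cancel_epi f.hom).mp e')

end General

variable {G : Type u} [Group G] [TopologicalSpace G] (D : Subgroup G)

/-! ### The points of the objects of `E₀`; the compatibility `ι' ∘ (P → P') = (Q → Q')|_D ∘ ι` -/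

/-- An object `(P, Q, ι)` of `E₀` has a point of `P` (connected objects are non-initial).
[cite: MochizukiFrdII2008, Ex. 1.4 (i) p.12] -/
theorem nonempty_left (T : ECat G D) : Nonempty T.obj.left.obj.obj.V :=
  BCat.nonempty_of_isNonemptyObj _ T.obj.left.property.1

/-- The compatibility square of a morphism of `E₀`, evaluated at a point: `ι'(a(p)) = b(ι(p))`.
[cite: MochizukiFrdII2008, Ex. 1.4 (i) p.12] -/
theorem w_apply {T T' : ECat G D} (f : T ⟶ T') (p : T.obj.left.obj.obj.V) :
    T'.obj.hom.hom.hom (f.hom.left.hom.hom.hom p) =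
      (f.hom.right.hom.hom.hom (T.obj.hom.hom.hom p) : T'.obj.right.obj.obj.V) :=
  congrArg (fun k => k.hom.hom p) f.hom.w

/-- The structure arrow `ι : P → Q|_D` of an object of `E₀` is injective on points.
[cite: MochizukiFrdII2008, Ex. 1.4 (i) p.12] -/
theorem hom_injective [IsTopologicalGroup G] (T : ECat G D) :
    Function.Injective T.obj.hom.hom.hom := by
  haveI : Mono T.obj.hom := T.property
  exact BCat.injective_of_mono T.obj.hom

variable [IsTopologicalGroup G]

/-- Two morphisms of `E₀` with the same `P`-component are equal: the `Q`-components agree at the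
image of a point of `P` and `Q` is a single orbit. [cite: MochizukiFrdII2008, Ex. 1.4 (ii) p.13] -/
theorem hom_eq_of_left_eq {T T' : ECat G D} {f f' : T ⟶ T'} (h : f.hom.left = f'.hom.left) :
    f = f' := by
  obtain ⟨p⟩ := nonempty_left D T
  apply ObjectProperty.hom_ext
  apply Comma.hom_ext _ _ h
  apply ObjectProperty.hom_ext
  apply BCat.hom_eq_of_apply_eq T.obj.right.property (T.obj.hom.hom.hom p)
  have w₁ := w_apply D f p
  have w₂ := w_apply D f' p
  rw [h] at w₁
  exact w₁.symm.trans w₂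

/-! ### `E₀` is connected and totally epimorphic; `E₀ → P₀` is faithful; `P₀` is totally epimorphic -/

/-- FrdII Ex. 1.4 (ii), p. 13: "`P₀` [= `B(D_v)⁰`] is totally epimorphic" — DISCHARGED.
[cite: MochizukiFrdII2008, Prop. 1.5 (iii) p.14] -/
theorem pTotallyEpimorphic_holds : PTotallyEpimorphic G D :=
  isTotallyEpimorphic_connectedPart D

/-- FrdII Ex. 1.4 (ii), p. 13: "`E₀ → P₀` is faithful" — DISCHARGED.
[cite: MochizukiFrdII2008, Ex. 1.4 (ii) p.13] -/
theorem toP₀Faithful_holds : ToP₀Faithful G D :=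
  ⟨fun {_ _} _ _ e => hom_eq_of_left_eq D e⟩

/-- FrdII Ex. 1.4 (ii), p. 13: "`E₀` is … totally epimorphic" — DISCHARGED (both components of a
morphism of `E₀` are maps between single orbits, hence epimorphisms).
[cite: MochizukiFrdII2008, Ex. 1.4 (ii) p.13] -/
theorem eTotallyEpimorphic_holds : ETotallyEpimorphic G D := by
  refine ⟨fun {T T'} f => ⟨fun {T''} g h e => ?_⟩⟩
  haveI : Epi f.hom.left := (pTotallyEpimorphic_holds D).epi f.hom.left
  have e' : f.hom.left ≫ g.hom.left = f.hom.left ≫ h.hom.left :=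
    congrArg (fun k => CommaMorphism.left (InducedCategory.Hom.hom k)) e
  exact hom_eq_of_left_eq D ((cancel_epi f.hom.left).mp e')

/-- FrdII Ex. 1.4 (ii), p. 13: "the category `E₀` is connected" — DISCHARGED: every object maps to
the object `(pt, pt, id)`. [cite: MochizukiFrdII2008, Ex. 1.4 (ii) p.13] -/
theorem eConnected_holds : EConnected G D := by
  obtain ⟨P₁, p₁, hP₁, hp₁⟩ := exists_point_obj (D : Type u)
  obtain ⟨Q₁, q₁, hQ₁, hq₁⟩ := exists_point_obj G
  let ι₁ : P₁ ⟶ (res G D).obj Q₁ := ObjectProperty.homMk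
    { hom := FintypeCat.homMk fun _ => (q₁ : ((res G D).obj Q₁).obj.V)
      comm := fun _ => FintypeCat.hom_ext _ _ fun _ => (hq₁ _).symm }
  have hι₁ : Mono ι₁ := BCat.mono_of_injective ι₁ fun a b _ => (hp₁ a).trans (hp₁ b).symm
  let T₁ : ECat G D := ⟨⟨⟨P₁, hP₁⟩, ⟨Q₁, hQ₁⟩, ι₁⟩, hι₁⟩
  have to₁ : ∀ T : ECat G D, Nonempty (T ⟶ T₁) := fun T =>
    ⟨ObjectProperty.homMk
      { left := ObjectProperty.homMk (ObjectProperty.homMk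
          { hom := FintypeCat.homMk fun _ => p₁
            comm := fun _ => FintypeCat.hom_ext _ _ fun _ => (hp₁ _).symm })
        right := ObjectProperty.homMk (ObjectProperty.homMk
          { hom := FintypeCat.homMk fun _ => q₁
            comm := fun _ => FintypeCat.hom_ext _ _ fun _ => (hq₁ _).symm })
        w := BCat.hom_ext_apply fun _ => (hq₁ _).trans (hq₁ _).symm }⟩
  haveI : Nonempty (ECat G D) := ⟨T₁⟩
  exact zigzag_isConnected fun T T' =>
    (Zigzag.of_hom (to₁ T).some).trans (Zigzag.of_inv (to₁ T').some)

/-- FrdII Ex. 1.4 (ii), p. 13, the injectivity half of the printed "`E₀ → P₀` induces a bijection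
`Aut_{E₀}(E₀) ⥲ Aut_{P₀}(P₀)`": the map on automorphism groups is injective (faithfulness). The
surjectivity half is not asserted (see the CAVEAT in the docstring of `AutBijective`).
[cite: MochizukiFrdII2008, Ex. 1.4 (ii) p.13] -/
theorem autBijective_injective (T : ECat G D) :
    Function.Injective fun a : Aut T => (toP₀ G D).mapIso a := by
  intro a b e
  have e' : (toP₀ G D).map a.hom = (toP₀ G D).map b.hom := congrArg Iso.hom e
  exact Iso.ext (hom_eq_of_left_eq D e')

/-! ### Test objects of `E₀`: `(D/(U ∩ D), G/U, ι)` for `U = Stab(q) ∩ Stab(q')` -/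

/-- Points of `P` fixed under `ι` by `d ∈ D` are fixed by `d` (`ι` is injective and equivariant).
[cite: MochizukiFrdII2008, Ex. 1.4 (i) p.12] -/
theorem smul_eq_of_mem_stabilizer (T : ECat G D) (z : T.obj.left.obj.obj.V) (d : D)
    (q : T.obj.right.obj.obj.V) (hq : T.obj.hom.hom.hom z = q)
    (hd : (d : G) ∈ MulAction.stabilizer G q) : d • z = z := by
  apply hom_injective D T
  have e₂ := MulAction.mem_stabilizer_iff.mp hd
  rw [← hq] at e₂
  exact (BCat.hom_smul T.obj.hom d z).trans e₂

/-- For points `q ∈ Q`, `q' ∈ Q'` of objects of `B(G)` and `U := Stab(q) ∩ Stab(q')` (open, of finite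
index), the object `T₄ = (D/(U ∩ D), G/U, dU∩D ↦ dU)` of `E₀` with its base point `p₄`: both components
are single orbits, and `T₄` maps to every `(P'', Q'', ι'')` through prescribed `U`-fixed points — the
test objects used for the FSM-description of Example 1.4 (ii). [cite: MochizukiFrdII2008, Ex. 1.4 (ii) p.13] -/
theorem exists_testObj (Q Q' : BCat G) (q : Q.obj.V) (q' : Q'.obj.V) :
    ∃ (T₄ : ECat G D) (p₄ : T₄.obj.left.obj.obj.V) (q₄ : T₄.obj.right.obj.obj.V),
      T₄.obj.hom.hom.hom p₄ = q₄ ∧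
      (∀ p : T₄.obj.left.obj.obj.V, ∃ d : D, d • p₄ = p) ∧
      (∀ z : T₄.obj.right.obj.obj.V, ∃ g : G, g • q₄ = z) ∧
      (∀ (Y : BCat G) (y : Y.obj.V),
          MulAction.stabilizer G q ⊓ MulAction.stabilizer G q' ≤ MulAction.stabilizer G y →
          ∃ b : T₄.obj.right.obj ⟶ Y, b.hom.hom q₄ = y) ∧
      (∀ (X : BCat D) (x : X.obj.V),
          (∀ d : D, (d : G) ∈ MulAction.stabilizer G q ⊓ MulAction.stabilizer G q' → d • x = x) →
          ∃ a : T₄.obj.left.obj ⟶ X, a.hom.hom p₄ = x) := by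
  haveI := BCat.finiteIndex_stabilizer Q q
  haveI := BCat.finiteIndex_stabilizer Q' q'
  have hUo : IsOpen ((MulAction.stabilizer G q ⊓ MulAction.stabilizer G q' : Subgroup G) : Set G) :=
    (BCat.isOpen_stabilizer Q q).inter (BCat.isOpen_stabilizer Q' q')
  obtain ⟨Q₄, q₄, hq₄, htrQ, hmapQ⟩ :=
    BCat.exists_coset_obj (MulAction.stabilizer G q ⊓ MulAction.stabilizer G q') hUo
  have hUDo : IsOpen (((MulAction.stabilizer G q ⊓ MulAction.stabilizer G q').subgroupOf D :
      Subgroup D) : Set D) := hUo.preimage continuous_subtype_val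
  obtain ⟨P₄, p₄, hp₄, htrP, hmapP⟩ := BCat.exists_coset_obj (G := D)
    ((MulAction.stabilizer G q ⊓ MulAction.stabilizer G q').subgroupOf D) hUDo
  -- `ι₄ : P₄ → Q₄|_D`, `p₄ ↦ q₄`
  obtain ⟨ι₄, hι₄⟩ := hmapP ((res G D).obj Q₄) q₄ fun d hd => by
    rw [Subgroup.mem_subgroupOf, ← hq₄] at hd
    exact MulAction.mem_stabilizer_iff.mpr (MulAction.mem_stabilizer_iff.mp hd)
  have hι₄m : Mono ι₄ := BCat.mono_of_injective ι₄ (BCat.injective_of_stabilizer_le ι₄ p₄ htrP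
    fun d hd => by
      rw [hp₄, Subgroup.mem_subgroupOf, ← hq₄]
      rw [hι₄] at hd
      exact MulAction.mem_stabilizer_iff.mpr (MulAction.mem_stabilizer_iff.mp hd))
  let T₄ : ECat G D :=
    ⟨⟨⟨P₄, BCat.isConnectedObj_of_transitive P₄ p₄ htrP⟩,
      ⟨Q₄, BCat.isConnectedObj_of_transitive Q₄ q₄ htrQ⟩, ι₄⟩, hι₄m⟩
  refine ⟨T₄, p₄, q₄, hι₄, htrP, htrQ, fun Y y hy => hmapQ Y y hy, ?_⟩
  · intro X x hx
    exact hmapP X x fun d hd => MulAction.mem_stabilizer_iff.mpr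
      (hx d ((Subgroup.mem_subgroupOf).mp hd))

/-! ### The FSM-morphisms of `E₀` -/

/-- FrdII Ex. 1.4 (ii), p. 13: the FSM-morphisms of `E₀` that are not isomorphisms are exactly the
morphisms whose `P`-component is an isomorphism [and which are not isomorphisms] — DISCHARGED.
(`⟹`: the `P`-component of a monomorphism of `E₀` is injective, by testing against
`(D/(U∩D), G/U)` for `U = Stab(ι x) ∩ Stab(ι y)`; `⟸`: every morphism of `E₀` is fiberwise surjective,
the test object for `U = Stab(ι x) ∩ Stab(ι₃ p₃)` dominating both, and a morphism with invertible
`P`-component is a monomorphism.) [cite: MochizukiFrdII2008, Ex. 1.4 (ii) p.13] -/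
theorem fsmDescription_holds : FSMDescription G D := by
  intro T T' f
  obtain ⟨p⟩ := nonempty_left D T
  -- morphisms `T₄ ⟶ T''` from components agreeing at the base point
  have mk : ∀ {T₄ T'' : ECat G D} (p₄ : T₄.obj.left.obj.obj.V) (q₄ : T₄.obj.right.obj.obj.V),
      T₄.obj.hom.hom.hom p₄ = q₄ → (∀ p : T₄.obj.left.obj.obj.V, ∃ d : D, d • p₄ = p) →
      ∀ (a : T₄.obj.left.obj ⟶ T''.obj.left.obj) (b : T₄.obj.right.obj ⟶ T''.obj.right.obj),
        T''.obj.hom.hom.hom (a.hom.hom p₄) = b.hom.hom q₄ →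
        ∃ u : T₄ ⟶ T'', u.hom.left = ObjectProperty.homMk a ∧ u.hom.right = ObjectProperty.homMk b :=
    fun {T₄ T''} p₄ q₄ hq htrP a b hab =>
      ⟨ObjectProperty.homMk
        { left := ObjectProperty.homMk a
          right := ObjectProperty.homMk b
          w := BCat.hom_eq_of_apply_eq_of_transitive p₄ htrP (by
            change T''.obj.hom.hom.hom (a.hom.hom p₄) = b.hom.hom (T₄.obj.hom.hom.hom p₄)
            rw [hq]
            exact hab) }, rfl, rfl⟩
  constructor
  · rintro ⟨⟨_, hmono⟩, hni⟩
    refine ⟨?_, hni⟩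
    have hsurj : Function.Surjective f.hom.left.hom.hom.hom :=
      BCat.surjective_of_isConnectedObj f.hom.left.hom p T'.obj.left.property
    have hinj : Function.Injective f.hom.left.hom.hom.hom := by
      intro x y hxy
      by_contra hne
      obtain ⟨T₄, p₄, q₄, hq₄, htrP, htrQ, hmapQ, hmapP⟩ := exists_testObj D T.obj.right.obj
        T.obj.right.obj (T.obj.hom.hom.hom x) (T.obj.hom.hom.hom y)
      obtain ⟨a₁, ha₁⟩ := hmapP T.obj.left.obj x fun d hd =>
        smul_eq_of_mem_stabilizer D T x d _ rfl (Subgroup.mem_inf.mp hd).1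
      obtain ⟨a₂, ha₂⟩ := hmapP T.obj.left.obj y fun d hd =>
        smul_eq_of_mem_stabilizer D T y d _ rfl (Subgroup.mem_inf.mp hd).2
      obtain ⟨b₁, hb₁⟩ := hmapQ T.obj.right.obj (T.obj.hom.hom.hom x) inf_le_left
      obtain ⟨b₂, hb₂⟩ := hmapQ T.obj.right.obj (T.obj.hom.hom.hom y) inf_le_right
      obtain ⟨u₁, hu₁l, hu₁r⟩ := mk p₄ q₄ hq₄ htrP a₁ b₁ (by rw [ha₁, hb₁])
      obtain ⟨u₂, hu₂l, hu₂r⟩ := mk p₄ q₄ hq₄ htrP a₂ b₂ (by rw [ha₂, hb₂])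
      have e : u₁ ≫ f = u₂ ≫ f := by
        apply ObjectProperty.hom_ext
        apply Comma.hom_ext
        · change u₁.hom.left ≫ f.hom.left = u₂.hom.left ≫ f.hom.left
          rw [hu₁l, hu₂l]
          apply ObjectProperty.hom_ext
          apply BCat.hom_eq_of_apply_eq_of_transitive p₄ htrP
          change f.hom.left.hom.hom.hom (a₁.hom.hom p₄) = f.hom.left.hom.hom.hom (a₂.hom.hom p₄)
          rw [ha₁, ha₂, hxy]
        · change u₁.hom.right ≫ f.hom.right = u₂.hom.right ≫ f.hom.right
          rw [hu₁r, hu₂r]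
          apply ObjectProperty.hom_ext
          apply BCat.hom_eq_of_apply_eq_of_transitive q₄ htrQ
          change f.hom.right.hom.hom.hom (b₁.hom.hom q₄) = f.hom.right.hom.hom.hom (b₂.hom.hom q₄)
          rw [hb₁, hb₂, ← w_apply D f x, ← w_apply D f y, hxy]
      haveI := hmono
      have e' : u₁ = u₂ := (cancel_mono f).mp e
      have : a₁.hom.hom p₄ = a₂.hom.hom p₄ := by
        have h := congrArg (fun k : T₄ ⟶ T => k.hom.left) e'
        rw [hu₁l, hu₂l] at h
        exact congrArg (fun k : T₄.obj.left ⟶ T.obj.left => k.hom.hom.hom p₄) h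
      rw [ha₁, ha₂] at this
      exact hne this
    haveI : IsIso f.hom.left.hom := BCat.isIso_of_bijective f.hom.left.hom ⟨hinj, hsurj⟩
    exact (ObjectProperty.isIso_hom_iff f.hom.left).mp inferInstance
  · rintro ⟨hiso, hni⟩
    refine ⟨⟨?_, ⟨fun {T''} u₁ u₂ e => ?_⟩⟩, hni⟩
    · -- fiberwise surjectivity
      intro T₃ γ
      obtain ⟨p₃⟩ := nonempty_left D T₃
      obtain ⟨x, hx⟩ := BCat.surjective_of_isConnectedObj f.hom.left.hom p T'.obj.left.property
        (γ.hom.left.hom.hom.hom p₃)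
      obtain ⟨T₄, p₄, q₄, hq₄, htrP, htrQ, hmapQ, hmapP⟩ := exists_testObj D T.obj.right.obj
        T₃.obj.right.obj (T.obj.hom.hom.hom x) (T₃.obj.hom.hom.hom p₃)
      obtain ⟨a₁, ha₁⟩ := hmapP T.obj.left.obj x fun d hd =>
        smul_eq_of_mem_stabilizer D T x d _ rfl (Subgroup.mem_inf.mp hd).1
      obtain ⟨a₂, ha₂⟩ := hmapP T₃.obj.left.obj p₃ fun d hd =>
        smul_eq_of_mem_stabilizer D T₃ p₃ d _ rfl (Subgroup.mem_inf.mp hd).2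
      obtain ⟨b₁, hb₁⟩ := hmapQ T.obj.right.obj (T.obj.hom.hom.hom x) inf_le_left
      obtain ⟨b₂, hb₂⟩ := hmapQ T₃.obj.right.obj (T₃.obj.hom.hom.hom p₃) inf_le_right
      obtain ⟨δ, hδl, hδr⟩ := mk p₄ q₄ hq₄ htrP a₁ b₁ (by rw [ha₁, hb₁])
      obtain ⟨ε, hεl, hεr⟩ := mk p₄ q₄ hq₄ htrP a₂ b₂ (by rw [ha₂, hb₂])
      refine ⟨T₄, δ, ε, ?_⟩
      apply ObjectProperty.hom_ext
      apply Comma.hom_ext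
      · change δ.hom.left ≫ f.hom.left = ε.hom.left ≫ γ.hom.left
        rw [hδl, hεl]
        apply ObjectProperty.hom_ext
        apply BCat.hom_eq_of_apply_eq_of_transitive p₄ htrP
        change f.hom.left.hom.hom.hom (a₁.hom.hom p₄) = γ.hom.left.hom.hom.hom (a₂.hom.hom p₄)
        rw [ha₁, ha₂, hx]
      · change δ.hom.right ≫ f.hom.right = ε.hom.right ≫ γ.hom.right
        rw [hδr, hεr]
        apply ObjectProperty.hom_ext
        apply BCat.hom_eq_of_apply_eq_of_transitive q₄ htrQ
        change f.hom.right.hom.hom.hom (b₁.hom.hom q₄) = γ.hom.right.hom.hom.hom (b₂.hom.hom q₄)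
        rw [hb₁, hb₂, ← w_apply D f x, ← w_apply D γ p₃, hx]
    · -- monomorphism
      have el : u₁.hom.left ≫ f.hom.left = u₂.hom.left ≫ f.hom.left :=
        congrArg (fun k => CommaMorphism.left (InducedCategory.Hom.hom k)) e
      haveI : IsIso f.hom.left := hiso
      exact hom_eq_of_left_eq D ((cancel_mono f.hom.left).mp el)

/-- FrdII Ex. 1.4 (ii), p. 13: "Thus, the category `E₀` is not [in general] of FSM-type" — DISCHARGED
in the typed form: a morphism of `E₀` with invertible `P`-component which is not an isomorphism is an
FSM-morphism that is not an isomorphism. [cite: MochizukiFrdII2008, Ex. 1.4 (ii) p.13] -/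
theorem notFSMType_holds : NotFSMType G D := by
  rintro ⟨T, T', f, hiso, hni⟩ hC
  exact hni (hC.isIso_of_isFSM f ((fsmDescription_holds D f).mpr ⟨hiso, hni⟩).1)

end NFLocCat

end Literature.AlgebraicGeometry.Frobenioids
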